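import Literature.AnabelianGeometry.AbsoluteAnabelian.AbsTopIProp410GraphSurjectivityPrelims
import Literature.GroupTheory.CombinatorialGroupTheory.FreeGroupSubgroupSeparable
import HarnessLib

/-!
# [AbsTopI] Prop 4.10 (iii): the graph-level residue (R2) "`H′ = f(f⁻¹H′) · H′^{co-fr}`" from
# topological finite generation of `Δ^tp_X`, by M. Hall's theorem (proof-only)

S. Mochizuki, *Topics in Absolute Anabelian Geometry I: Generalities* [AbsTopI] (J. Math. Sci.
Univ. Tokyo 19 (2012)), §0 p. 8, Prop 4.10 (iii) p. 60 (proof p. 61 l. 31 "follows immediately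
from assertion (i)", with p. 60 l. 8–13: "`H ↠ H/H^{co-fr}` corresponds to the tempered covering
[...] determined by the universal covering of the dual graph of the special fiber of a stable
model"); manuscript pagination, lit key `paper:url-11ac98ba15fc`, read on the page.  S. Mochizuki,
*Semi-graphs of anabelioids* [SemiAnbd] Lem 6.3 (i) p. 70 ("Let `F` be a finitely generated free
group [...] `H ⊆ F` [...] finitely generated [...] dense in `F̂`.  Then `H = F`"), §6 p. 69.
M. Hall, *Coset representations in free groups*, Trans. AMS 67 (1949); Lyndon–Schupp,
*Combinatorial Group Theory* Ch. I Prop. 3.10 — PROVED in the tree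
(`Literature.GroupTheory.CombinatorialGroupTheory.eq_top_of_fg_of_forall_sup_eq_top`,
`FreeGroupSubgroupSeparable.lean`).

Context: node AbsTopI:Prop4.10(iii) of the cell's sub-DAG `HOME/plan/L4/SUBDAG-AbsTopI-Prop410.md`.
Its closers (`prop410iiiAt_of_residues''''`, `AbsTopIProp410SameFieldProofs.lean`) carry the
GRAPH-LEVEL residue

  (R2)  `H′ ≤ f(f⁻¹H′) · H′^{co-fr}` for every Y-index `H′`

— surjectivity of `f⁻¹H′ → H′/H′^{co-fr} = π₁(Γ_{Y_{H′}})`, the surjective half of "filling in a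
cusp does not change the dual graph" (gen 5: `le_sup_cofreeCore_iff`, `denseRange_fDelta_iff`).
THIS FILE PROVES (R2) (`DeCuspidalization.le_mapComap_sup_cofreeCore_of_tfg`) from the TOPOLOGICAL
FINITE GENERATION of `Δ^tp_X` together with L3's parameter bundles `dX`, `dY` and §0 p. 8's standing
hypothesis for `H′`, by pure group theory: with `S := f(f⁻¹H′) ≤ H′` and `F := H′/H′^{co-fr}` FREE,
(1) `S` is profinitely dense in `H′` — `H′ = S · (H′ ∩ N)` for every open normal finite-index
`N ⊴ Π^tp_Y` (`le_mapComap_sup_inf`, from `f̂(Δ_X) = Δ_Y`); (2) every finite-index `P′ ⊇ H′^{co-fr}`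
of `H′` is cut out by such an `N` (`exists_openNormal_finiteIndex_inf_le`); so (3) the image `S̄` of
`S` in `F` meets every finite-index normal subgroup of `F` in a supplement; (4) `S̄` is finitely
generated — `f⁻¹H′` is open of finite index in the topologically finitely generated `Δ^tp_X`, hence
topologically finitely generated, and `F` is DISCRETE; (5) M. Hall: a finitely generated profinitely
dense subgroup of a free group is everything (`sup_ker_eq_top_of_fg_map`), so `S̄ = F`, i.e.
`H′ = S · H′^{co-fr}`.

CONSEQUENCES: `DenseRange E.fDelta` ("`Δ^tp_X → Δ^tp_Y` is dense", [AbsTopI] Def 4.11 (i)(c)) from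
{(CF_Δ), hmin, tfg `Δ^tp_X`, dX, dY} (`DeCuspidalization.denseRange_fDelta_of_tfg`), and BOTH
clauses of node (iii) AT THE CONSTRUCTION over the FIVE residues {(CF_Δ), conj. 1 of
`CoFreeCofinalImAlong`, tfg `Δ^tp_X`, GroupLevelData ×2, hmin} —
`prop410iiiAt_of_geometric_residues`, `prop410iiiDeltaAt_of_geometric_residues` (residues (c) tfg
`Δ̂_X`, (d) `X.K = Y.K`, (f) (R2) of GAP row G-L4t13g5-1 all discharged, given tfg `Δ^tp_X`).

Inputs are hypotheses stated in the signatures (no new named facts; FACT-LIST untouched).  HONEST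
FRAMING: refereed prerequisite papers; nothing here bears on [IUTchIII] Cor 3.12; typed ≠ proved.
-/

noncomputable section

open _root_.Topology Filter

namespace Literature.AnabelianGeometry.AbsoluteAnabelian.AbsTopI.Prop410

open Literature.AnabelianGeometry.SemiGraphs
open Literature.AnabelianGeometry.AbsoluteAnabelian.AbsTopI
open Literature.GroupTheory.CombinatorialGroupTheory

variable {p : ℕ} [Fact p.Prime]

/-! ### M. Hall along a surjection onto a free group (finite generation of the image) -/

/-- **M. Hall, relative form with finite generation of the IMAGE**: for a surjection `ψ : G ↠ F(β)`
onto a free group and `H ≤ G` whose image `ψ(H)` is finitely generated, if `H P = G` for every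
normal finite-index `P ⊇ ker ψ`, then `H · ker ψ = G` (the tree's `sup_ker_eq_top_of_fg`, with
`H.FG` weakened to `(H.map ψ).FG` — same proof). [cite: LyndonSchupp2001, Ch. I Prop. 3.10] -/
theorem sup_ker_eq_top_of_fg_map {G : Type*} [Group G] {β : Type*} (ψ : G →* FreeGroup β)
    (hψ : Function.Surjective ψ) (H : Subgroup G) (hH : (H.map ψ).FG)
    (h : ∀ P : Subgroup G, P.Normal → P.FiniteIndex → ψ.ker ≤ P → H ⊔ P = ⊤) :
    H ⊔ ψ.ker = ⊤ := by
  have hmap : H.map ψ = ⊤ := by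
    refine eq_top_of_fg_of_forall_sup_eq_top _ hH fun P hPn hPf => ?_
    haveI := hPn
    haveI : (P.comap ψ).FiniteIndex :=
      ⟨by rw [Subgroup.index_comap_of_surjective _ hψ]; exact hPf.index_ne_zero⟩
    have hc : H ⊔ P.comap ψ = ⊤ :=
      h _ inferInstance inferInstance fun x hx => by
        rw [Subgroup.mem_comap, (MonoidHom.mem_ker).1 hx]; exact one_mem P
    have := congrArg (Subgroup.map ψ) hc
    rwa [Subgroup.map_sup, Subgroup.map_comap_eq_self_of_surjective hψ, ← MonoidHom.range_eq_map,
      MonoidHom.range_eq_top.2 hψ] at this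
  rw [← Subgroup.comap_map_eq, hmap, Subgroup.comap_top]

/-! ### (R2) from topological finite generation of `Δ^tp_X` -/

namespace DeCuspidalization

variable {X Y : TemperedCurve p} (E : DeCuspidalization X Y)

/-- **(R2) PROVED from tfg of `Δ^tp_X`** — "`H′ = f(f⁻¹H′) · H′^{co-fr}`": for a de-cuspidalization
datum `E`, L3's parameter bundles `dX`, `dY`, `Δ^tp_X` topologically finitely generated, and a
Y-index `H′` admitting a minimal co-free subgroup ([AbsTopI] §0 p. 8), the subgroup `f(f⁻¹H′)`
maps ONTO the free group `H′/H′^{co-fr}` ("`π₁` of the dual graph of `Y_{H′}`") — by M. Hall's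
theorem applied to its finitely generated, profinitely dense image.
[cite: MochizukiAbsTopI2012, Prop 4.10 (iii) p.60] -/
theorem le_mapComap_sup_cofreeCore_of_tfg (dX : X.GroupLevelData) (dY : Y.GroupLevelData)
    (htfg : IsTopologicallyFinitelyGenerated X.DeltaTemp) (H' : CharOpenSubgroup Y.DeltaTemp)
    {M : Subgroup Y.PiTemp} (hM : IsMinimalCofreeIn H'.toSubgroup M) :
    H'.toSubgroup ≤ (H'.toSubgroup.comap E.f.toMonoidHom).map E.f.toMonoidHom ⊔
      cofreeCore H'.toSubgroup := by
  classical
  haveI : Y.DeltaTemp.Normal := by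
    unfold TemperedCurve.DeltaTemp
    infer_instance
  haveI : H'.toSubgroup.Normal := H'.normal
  obtain ⟨hMle, hMn, hcf⟩ := hM.1
  have hCM : cofreeCore H'.toSubgroup = M := cofreeCore_eq_of_isMinimalCofreeIn hM
  -- the group `H′`, its co-free kernel `Cs = H′^{co-fr}` (open, free quotient) and `ψ : H′ ↠ F(β)`
  let Cs : Subgroup H'.toSubgroup := M.subgroupOf H'.toSubgroup
  haveI : Cs.Normal := hMn
  haveI : IsFreeGroup (H'.toSubgroup ⧸ Cs) := hcf.isFreeGroup_quotient
  let e : (H'.toSubgroup ⧸ Cs) ≃* FreeGroup (IsFreeGroup.Generators (H'.toSubgroup ⧸ Cs)) :=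
    IsFreeGroup.toFreeGroup (H'.toSubgroup ⧸ Cs)
  let ψ : H'.toSubgroup →* FreeGroup (IsFreeGroup.Generators (H'.toSubgroup ⧸ Cs)) :=
    e.toMonoidHom.comp (QuotientGroup.mk' Cs)
  have hψs : Function.Surjective ψ := e.surjective.comp (QuotientGroup.mk'_surjective Cs)
  have hkerψ : ψ.ker = Cs := by
    change (e.toMonoidHom.comp (QuotientGroup.mk' Cs)).ker = Cs
    rw [← MonoidHom.comap_ker, (MonoidHom.ker_eq_bot_iff _).mpr e.injective, MonoidHom.comap_bot,
      QuotientGroup.ker_mk']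
  have hmemker : ∀ x : H'.toSubgroup, ψ x = 1 ↔ (x : Y.PiTemp) ∈ M := fun x => by
    rw [← MonoidHom.mem_ker, hkerψ, Subgroup.mem_subgroupOf]
  -- `S := f(f⁻¹H′) ≤ H′`, viewed inside `H′`
  let S : Subgroup Y.PiTemp := (H'.toSubgroup.comap E.f.toMonoidHom).map E.f.toMonoidHom
  have hSH : S ≤ H'.toSubgroup := Subgroup.map_comap_le _ _
  let Hs : Subgroup H'.toSubgroup := S.subgroupOf H'.toSubgroup
  -- (4) the image of `S` in `F(β)` is finitely generated (`f⁻¹H′ ∩ Δ^tp_X` tfg, `H′^{co-fr}` open)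
  let U : Subgroup X.DeltaTemp := (H'.toSubgroup.subgroupOf Y.DeltaTemp).comap E.fDelta.toMonoidHom
  have hUo : IsOpen (U : Set X.DeltaTemp) := H'.isOpen.preimage E.fDelta.continuous
  haveI : (H'.toSubgroup.subgroupOf Y.DeltaTemp).FiniteIndex := H'.finiteIndex
  haveI : U.FiniteIndex := by
    refine ⟨?_⟩
    rw [Subgroup.index_comap]
    exact Subgroup.FiniteIndex.index_ne_zero
  have hUtfg : IsTopologicallyFinitelyGenerated U := htfg.subgroup_isOpen_of_finiteIndex U hUo
  have hUmem : ∀ u : U, E.f ((u : X.DeltaTemp) : X.PiTemp) ∈ H'.toSubgroup := fun u =>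
    Subgroup.mem_subgroupOf.mp (Subgroup.mem_comap.mp u.2)
  let fU : U →* H'.toSubgroup :=
    { toFun := fun u => ⟨E.f ((u : X.DeltaTemp) : X.PiTemp), hUmem u⟩
      map_one' := Subtype.ext (by simp)
      map_mul' := fun a b => Subtype.ext (by simp) }
  have hfUc : Continuous fU :=
    (E.f.continuous.comp (continuous_subtype_val.comp continuous_subtype_val)).subtype_mk _
  let Φ : U →* FreeGroup (IsFreeGroup.Generators (H'.toSubgroup ⧸ Cs)) := ψ.comp fU
  have hfUS : ∀ u : U, fU u ∈ Hs := fun u =>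
    Subgroup.mem_subgroupOf.mpr ⟨((u : X.DeltaTemp) : X.PiTemp), hUmem u, rfl⟩
  obtain ⟨t, ht⟩ := hUtfg.exists_finset
  have hFG : (Hs.map ψ).FG := by
    refine ⟨t.image Φ, le_antisymm ?_ ?_⟩
    · rw [Subgroup.closure_le, Finset.coe_image]
      rintro _ ⟨u, -, rfl⟩
      exact ⟨fU u, hfUS u, rfl⟩
    · rintro _ ⟨x, hx, rfl⟩
      obtain ⟨g, hg, hgx⟩ := Subgroup.mem_subgroupOf.mp hx
      have hgΔ : g ∈ X.DeltaTemp := E.comap_le_deltaTemp H'.le hg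
      have hgU : (⟨g, hgΔ⟩ : X.DeltaTemp) ∈ U :=
        Subgroup.mem_comap.mpr (Subgroup.mem_subgroupOf.mpr (Subgroup.mem_comap.mp hg))
      let u : U := ⟨⟨g, hgΔ⟩, hgU⟩
      have hux : fU u = x := Subtype.ext hgx
      -- the fibre of `Φ` through `u` is open (it is `fU⁻¹(fU u · Cs)`), so it meets the dense `⟨t⟩`
      have hO : IsOpen (fU ⁻¹' ((fun v : H'.toSubgroup => fU u * v) '' (Cs : Set H'.toSubgroup))) :=
        ((Homeomorph.mulLeft (fU u)).isOpenMap _ hcf.isOpen).preimage hfUc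
      have hne : (fU ⁻¹' ((fun v : H'.toSubgroup => fU u * v) ''
          (Cs : Set H'.toSubgroup))).Nonempty := ⟨u, 1, Cs.one_mem, mul_one _⟩
      have hdense : _root_.Dense ((Subgroup.closure (t : Set U) : Subgroup U) : Set U) := by
        rw [dense_iff_closure_eq, ← Subgroup.topologicalClosure_coe, ht, Subgroup.coe_top]
      obtain ⟨d, hdO, hdt⟩ := hdense.inter_open_nonempty _ hO hne
      obtain ⟨c, hc, hcd⟩ := hdO
      -- `Φ d = Φ u`
      have hψc : ψ c = 1 := (hmemker c).mpr (Subgroup.mem_subgroupOf.mp hc)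
      have hcd' : fU u * c = fU d := hcd
      have hΦ : ψ (fU u) = Φ d := by
        show ψ (fU u) = ψ (fU d)
        rw [← hcd', map_mul, hψc, mul_one]
      rw [← hux, hΦ, Finset.coe_image, ← MonoidHom.map_closure]
      exact ⟨d, hdt, rfl⟩
  -- (1)–(3) the density hypothesis of Hall's theorem
  have hHall : ∀ P : Subgroup H'.toSubgroup, P.Normal → P.FiniteIndex → ψ.ker ≤ P →
      Hs ⊔ P = ⊤ := by
    intro P hPn hPf hkP
    let P' : Subgroup Y.PiTemp := P.map H'.toSubgroup.subtype
    have hP'H : P' ≤ H'.toSubgroup := Subgroup.map_subtype_le _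
    have hP'sub : P'.subgroupOf H'.toSubgroup = P :=
      Subgroup.comap_map_eq_self_of_injective H'.toSubgroup.subtype_injective P
    have hCP : cofreeCore H'.toSubgroup ≤ P' := by
      intro c hc
      have hcH : c ∈ H'.toSubgroup := cofreeCore_le _ hc
      have hck : (⟨c, hcH⟩ : H'.toSubgroup) ∈ ψ.ker := by
        rw [hkerψ, Subgroup.mem_subgroupOf]
        rw [hCM] at hc
        exact hc
      exact ⟨⟨c, hcH⟩, hkP hck, rfl⟩
    have hfi : (P'.subgroupOf H'.toSubgroup).FiniteIndex := by rw [hP'sub]; exact hPf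
    obtain ⟨N, hNf, hNP⟩ := exists_openNormal_finiteIndex_inf_le dY H' hM hP'H hCP hfi
    have hdense := E.le_mapComap_sup_inf dX dY H' N hNf
    haveI : (H'.toSubgroup ⊓ N.toSubgroup).Normal := Subgroup.normal_inf_normal _ _
    rw [eq_top_iff]
    rintro x -
    have hx : (x : Y.PiTemp) ∈ ((S ⊔ (H'.toSubgroup ⊓ N.toSubgroup) : Subgroup Y.PiTemp) :
        Set Y.PiTemp) := hdense x.2
    rw [Subgroup.mul_normal] at hx
    obtain ⟨s, hs, m, hm, hsm⟩ := Set.mem_mul.mp hx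
    have hmP : (⟨m, hm.1⟩ : H'.toSubgroup) ∈ P := by
      rw [← hP'sub, Subgroup.mem_subgroupOf]
      exact hNP m hm.2 hm.1
    have hsS : (⟨s, hSH hs⟩ : H'.toSubgroup) ∈ Hs := Subgroup.mem_subgroupOf.mpr hs
    have hxe : x = ⟨s, hSH hs⟩ * ⟨m, hm.1⟩ := Subtype.ext hsm.symm
    rw [hxe]
    exact Subgroup.mul_mem_sup hsS hmP
  -- (5) M. Hall
  have hall : Hs ⊔ ψ.ker = ⊤ := sup_ker_eq_top_of_fg_map ψ hψs Hs hFG hHall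
  -- conclusion
  intro h hh
  have hx : (⟨h, hh⟩ : H'.toSubgroup) ∈
      ((Hs ⊔ Cs : Subgroup H'.toSubgroup) : Set H'.toSubgroup) := by
    rw [← hkerψ, hall]
    exact Subgroup.mem_top _
  rw [Subgroup.mul_normal] at hx
  obtain ⟨a, ha, c, hc, hac⟩ := Set.mem_mul.mp hx
  have hh' : h = (a : Y.PiTemp) * (c : Y.PiTemp) := by
    rw [← Subgroup.coe_mul, hac]
  rw [hh']
  refine Subgroup.mul_mem_sup (Subgroup.mem_subgroupOf.mp ha) ?_
  rw [hCM]
  exact Subgroup.mem_subgroupOf.mp hc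

/-- **(R2) for every Y-index** under §0 p. 8's standing hypothesis `hmin`.
[cite: MochizukiAbsTopI2012, Prop 4.10 (iii) p.60] -/
theorem graphSurj_of_tfg (dX : X.GroupLevelData) (dY : Y.GroupLevelData)
    (htfg : IsTopologicallyFinitelyGenerated X.DeltaTemp)
    (hmin : ∀ H' : CharOpenSubgroup Y.DeltaTemp, ∃ M, IsMinimalCofreeIn H'.toSubgroup M)
    (H' : CharOpenSubgroup Y.DeltaTemp) :
    H'.toSubgroup ≤ (H'.toSubgroup.comap E.f.toMonoidHom).map E.f.toMonoidHom ⊔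
      cofreeCore H'.toSubgroup := by
  obtain ⟨M, hM⟩ := hmin H'
  exact E.le_mapComap_sup_cofreeCore_of_tfg dX dY htfg H' hM

/-- **"`Δ^tp_X → Δ^tp_Y` is DENSE"** ([AbsTopI] Def 4.11 (i)(c) pp. 62–63, the printed property of
the tempered arrow of a de-cuspidalization; row iii.L03) at genuine data, from André's basis clause
(CF_Δ), `hmin`, tfg of `Δ^tp_X` and L3's parameter bundles.
[cite: MochizukiAbsTopI2012, Def 4.11 (i) p.62] -/
theorem denseRange_fDelta_of_tfg (dX : X.GroupLevelData) (dY : Y.GroupLevelData)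
    (hΔ : ∀ N : OpenNormalSubgroup Y.DeltaTemp, ∃ H' : CharOpenSubgroup Y.DeltaTemp,
      (cofreeCore H'.toSubgroup).subgroupOf Y.DeltaTemp ≤ N.toSubgroup)
    (hmin : ∀ H' : CharOpenSubgroup Y.DeltaTemp, ∃ M, IsMinimalCofreeIn H'.toSubgroup M)
    (htfg : IsTopologicallyFinitelyGenerated X.DeltaTemp) : DenseRange E.fDelta :=
  denseRange_fDelta_of_graphSurj E ((selfCompletionAt_iff_cofreeCore_cofinal_delta dY hmin).mpr hΔ)
    dX dY (E.graphSurj_of_tfg dX dY htfg hmin)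

end DeCuspidalization

/-! ### Node (iii), both clauses, over the five residues -/

/-- **[AbsTopI] Prop 4.10 (iii), Π-clause, AT THE CONSTRUCTION over the residues {(CF_Δ), conj. 1 of
`CoFreeCofinalImAlong`, tfg `Δ^tp_X`, GroupLevelData ×2, hmin}** — (c) tfg `Δ̂_X`, (d) `X.K = Y.K`
and (f) (R2) being theorems. [cite: MochizukiAbsTopI2012, Prop 4.10 (iii) p.60] -/
theorem prop410iiiAt_of_geometric_residues {X Y : TemperedCurve p} (E : DeCuspidalization X Y)
    (hΔ : ∀ N : OpenNormalSubgroup Y.DeltaTemp, ∃ H' : CharOpenSubgroup Y.DeltaTemp,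
      (cofreeCore H'.toSubgroup).subgroupOf Y.DeltaTemp ≤ N.toSubgroup)
    (hleft : ∀ H : CharOpenSubgroup X.DeltaTemp, ∃ H' : CharOpenSubgroup Y.DeltaTemp,
      coFreeKernel ((ContinuousMonoidHom.id Y.PiHat).comp Y.toHat) H'.toSubgroup ≤
        coFreeKernel (E.fHat.comp X.toHat) H.toSubgroup)
    (htfg : IsTopologicallyFinitelyGenerated X.DeltaTemp)
    (dX : X.GroupLevelData) (dY : Y.GroupLevelData)
    (hmin : ∀ H' : CharOpenSubgroup Y.DeltaTemp, ∃ M, IsMinimalCofreeIn H'.toSubgroup M) :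
    Prop410iiiAt E :=
  prop410iiiAt_of_residues'''' E hΔ hleft
    (isTopologicallyFinitelyGenerated_deltaHat_of_deltaTemp X htfg) dX dY
    (E.graphSurj_of_tfg dX dY htfg hmin) hmin

/-- **[AbsTopI] Prop 4.10 (iii), Δ-clause, AT THE CONSTRUCTION over the same five residues.**
[cite: MochizukiAbsTopI2012, Prop 4.10 (iii) p.60] -/
theorem prop410iiiDeltaAt_of_geometric_residues {X Y : TemperedCurve p} (E : DeCuspidalization X Y)
    (hΔ : ∀ N : OpenNormalSubgroup Y.DeltaTemp, ∃ H' : CharOpenSubgroup Y.DeltaTemp,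
      (cofreeCore H'.toSubgroup).subgroupOf Y.DeltaTemp ≤ N.toSubgroup)
    (hleft : ∀ H : CharOpenSubgroup X.DeltaTemp, ∃ H' : CharOpenSubgroup Y.DeltaTemp,
      coFreeKernel ((ContinuousMonoidHom.id Y.PiHat).comp Y.toHat) H'.toSubgroup ≤
        coFreeKernel (E.fHat.comp X.toHat) H.toSubgroup)
    (htfg : IsTopologicallyFinitelyGenerated X.DeltaTemp)
    (dX : X.GroupLevelData) (dY : Y.GroupLevelData)
    (hmin : ∀ H' : CharOpenSubgroup Y.DeltaTemp, ∃ M, IsMinimalCofreeIn H'.toSubgroup M) :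
    Prop410iiiDeltaAt E :=
  prop410iiiDeltaAt_of_residues'''' E hΔ hleft
    (isTopologicallyFinitelyGenerated_deltaHat_of_deltaTemp X htfg) dX dY
    (E.graphSurj_of_tfg dX dY htfg hmin) hmin

end Literature.AnabelianGeometry.AbsoluteAnabelian.AbsTopI.Prop410

end
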